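import Mathlib
import Literature.Barriers.ValiantsHypothesis.AlgebraicNaturalProofs
import Literature.Computability.AlgebraicComplexity.KRSTSelection
import Literature.Barriers.ValiantsHypothesis.GKSS17FSVPresentation
import Summits.ValiantsHypothesis.ValiantsHypothesis.Theorems.BarrierLeverSuccinctHittingSetsForVPDimensionCount
import Summits.ValiantsHypothesis.ValiantsHypothesis.Theorems.BarrierLeverNaturalProofsSeparateVNPSignSliceIntVec
import Summits.ValiantsHypothesis.ValiantsHypothesis.Theorems.BarrierLeverNaturalProofsSeparateVNPSignSliceCRT
import Summits.ValiantsHypothesis.ValiantsHypothesis.Theorems.BarrierLeverNaturalProofsSeparateVNPSignSliceHittingPoint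
import Summits.ValiantsHypothesis.ValiantsHypothesis.Theorems.BarrierLeverNaturalProofsSeparateVNPSignSliceEquation
import HarnessLib

/-!
# Item `BarrierLever.NaturalProofsSeparateVNP` (stmt-ValiantsHypothesis-18972), SIGN SLICE —
# part 5: natural proofs against `VP ∩ {0,1,-1}`-coefficients EXIST (CKRST 2020, Thm. 1.1, tree frame)

**What is proved (unconditional; it does NOT close the item).** Item 18972 asks for level-one
algebraic natural proofs vanishing on ALL of `SmallCircuits ℂ n b` (coefficients unrestricted) and
nonzero at an explicit `VNP` family. Chatterjee–Kumar–Ramya–Saptharishi–Tengse 2020 (Thm. 1.1) prove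
the SIGN-SLICE version unconditionally: equations in `VP_N` exist for the polynomials of `VP` with
coefficients in `{0, 1, -1}`. This file formalises that theorem in the tree's frame (`d = n`,
`N = C(2n,n)` coefficient variables `degLEMonomials n`, distinguishers of size and degree `≤ N^a`,
slice `signCoeffSlice ℂ n`), with ONE distinguisher level `a = 5` serving every size exponent `b`:

* `signSlice_naturalProofRel` — `∃ a (= 5), ∀ b, ∃ n₀, ∀ n ≥ n₀, ∃ D, IsNaturalProofRel (degLEMonomials n)
  (signCoeffSlice ℂ n) (SmallCircuits ℂ n b) (Distinguishers ℂ n a) D ∧ ∃ h ∈ signCoeffSlice ℂ n,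
  deg h ≤ n ∧ D(coeff h) ≠ 0` — and the weaker `∀ b, ∃ a n₀, …` form `signSlice_naturalProofRel'`
  (the N3 load-bearing statement `CKRST2020_thm_1_1` of the cell val-lit, tree frame);
* `not_succinctHittingSetsForVPRel_signCoeffSlice` — hence the `signCoeffSlice`-relative form of FSV
  Question 6 (`Literature…SuccinctHittingSetsForVPRel ℂ (signCoeffSlice ℂ)`) is FALSE: the tree's
  narrowed barrier `AlgebraicNaturalProofsNarrow` recorded this slice as "refuted in print, not
  formalised" — it is now formalised.

**How it compares with the item (the two gaps, both genuine).** (1) Here `D` vanishes on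
`SmallCircuits ℂ n b ∩ signCoeffSlice ℂ n` only, not on all of `SmallCircuits ℂ n b`; (2) the
non-vanishing witness `h` is a sign polynomial obtained by pigeonhole (Siegel), not a member of an
explicit `VNP_{n,b₁}` family — indeed CKRST Thm. 1.3 shows such equations also kill
`VNP ∩ {0,1,-1}`. Nothing here bears on FSV Question 6 / crux 14610 or on `VP ≠ VNP`.

**Proof** (CKRST §4 with two substitutions, all inputs in the tree / Mathlib): the coefficient
vectors of `SmallCircuits ℂ n b` lie on the image of Raz's polynomial map with
`p ≤ 9376 (n+4)^(5b+21)` parameters and degree `≤ 2n` (tree `exists_parametrization`), so by the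
zero-pattern count (part 1) at most `(4n(n+1)^n+1)^p` SIGN vectors are coefficient vectors of small
circuits; a Schwartz–Zippel union bound gives ONE point `a ∈ [1, B]^n`, `B = hitBound n b`, with
`f(a) ≠ 0` for all of them (part 3; replaces Heintz–Schnorr); the equation is CKRST's
`Λ · ∏_{r=2}^{2N} Q_{2N²,r}(∑_m z_m (a^m mod r))` (part 4) with all moduli `r ≤ 2N` in place of primes
(part 2: `0 < |x| < 2^N ⇒ r ∤ x` for some `r ≤ 2N`); the witness is a nonzero sign polynomial `h`
with `h(a) = 0` (part 3, pigeonhole `N · B^n + 1 < 2^N`, which holds for `n ≥ n₀(b)` since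
`log₂ B = poly_b(n)` while `N ≥ 2^n`).

References: [ChatterjeeKumarRamyaSaptharishiTengse2020] Thm. 1.1 and §4; [ForbesShpilkaVolk2018]
Def. 1, Def. 3, Question 6; [RonyaiBabaiGanapathy2001] Thm. 1.1; [Raz2010] Prop. 3.3.
-/

-- layout Summits/ValiantsHypothesis/ValiantsHypothesis forces the duplicated namespace component
set_option linter.dupNamespace false

noncomputable section

namespace Summit.ValiantsHypothesis.ValiantsHypothesis.Theorems.BarrierLever.NaturalProofsSeparateVNP

open Literature.Barriers.ValiantsHypothesis Literature.Computability.AlgebraicComplexity MvPolynomial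
open Summit.ValiantsHypothesis.ValiantsHypothesis.Theorems.BarrierLever.SuccinctHittingSetsForVP

namespace SignSlice

/-! ### Counting the coordinates -/

/-- `2^n ≤ N = #degLEMonomials n` (the multilinear monomials). [folklore] -/
theorem two_pow_le_card_degLEMonomials (n : ℕ) : 2 ^ n ≤ Fintype.card (degLEMonomials n) := by
  classical
  let φ : (Fin n → Fin 2) → degLEMonomials n := fun u =>
    ⟨Finsupp.equivFunOnFinite.symm fun i => (u i : ℕ), by
      show Finsupp.degree _ ≤ n
      rw [Finsupp.degree_eq_sum]
      calc ∑ i, (Finsupp.equivFunOnFinite.symm fun i => ((u i : Fin 2) : ℕ)) i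
          ≤ ∑ _i : Fin n, 1 := Finset.sum_le_sum fun i _ => by
            rw [Finsupp.coe_equivFunOnFinite_symm]; have := (u i).isLt; omega
        _ = n := by simp⟩
  have hφ : Function.Injective φ := by
    intro u v h
    funext i
    have := congrArg (fun m : degLEMonomials n => (m : Fin n →₀ ℕ) i) h
    simp only [φ, Finsupp.coe_equivFunOnFinite_symm] at this
    exact Fin.ext this
  have := Fintype.card_le_of_injective φ hφ
  simpa using this

/-- `N = #degLEMonomials n = C(2n, n)` as a `Fintype.card` (the tree's `GKSS2017.card_degLEMonomials`,
typer t19, is the `Nat.card` form). [cite: ForbesShpilkaVolk2018, Cor. 5] -/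
theorem fintypeCard_degLEMonomials (n : ℕ) :
    Fintype.card (degLEMonomials n) = (2 * n).choose n := by
  rw [← Nat.card_eq_fintype_card]; exact GKSS2017.card_degLEMonomials n

/-! ### The size of the hitting point, in bits -/

/-- `4n(n+1)^n + 1 ≤ 2^(n² + n + 3)`. [folklore] -/
theorem base_le_two_pow (n : ℕ) : 4 * n * (n + 1) ^ n + 1 ≤ 2 ^ (n * n + n + 3) := by
  have h1 : n + 1 ≤ 2 ^ n := Nat.lt_two_pow_self
  have h2 : (n + 1) ^ n ≤ 2 ^ (n * n) := by
    calc (n + 1) ^ n ≤ (2 ^ n) ^ n := Nat.pow_le_pow_left h1 n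
      _ = 2 ^ (n * n) := by rw [← pow_mul]
  have h3 : 4 * n ≤ 2 ^ (n + 2) := by
    have : n ≤ 2 ^ n := (Nat.lt_two_pow_self).le
    rw [pow_add]; omega
  have h4 : 1 ≤ 2 ^ (n * n + n + 2) := Nat.one_le_two_pow
  calc 4 * n * (n + 1) ^ n + 1 ≤ 2 ^ (n + 2) * 2 ^ (n * n) + 1 := by gcongr
    _ = 2 ^ (n * n + n + 2) + 1 := by rw [← pow_add]; ring_nf
    _ ≤ 2 ^ (n * n + n + 2) + 2 ^ (n * n + n + 2) := by omega
    _ = 2 ^ (n * n + n + 3) := by ring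

/-- `hitBound n b ≤ 2^((n²+n+3)·P + n + 1)`, `P = 9376 (n+4)^(5b+21)`. [folklore] -/
theorem hitBound_le_two_pow (n b : ℕ) :
    hitBound n b ≤ 2 ^ ((n * n + n + 3) * (9376 * (n + 4) ^ (5 * b + 21)) + n + 1) := by
  set P := 9376 * (n + 4) ^ (5 * b + 21) with hP
  have hZ : (4 * n * (n + 1) ^ n + 1) ^ P ≤ 2 ^ ((n * n + n + 3) * P) := by
    calc (4 * n * (n + 1) ^ n + 1) ^ P ≤ (2 ^ (n * n + n + 3)) ^ P :=
          Nat.pow_le_pow_left (base_le_two_pow n) P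
      _ = 2 ^ ((n * n + n + 3) * P) := by rw [← pow_mul]
  have hn : n ≤ 2 ^ n := (Nat.lt_two_pow_self).le
  have h1 : 1 ≤ 2 ^ ((n * n + n + 3) * P + n) := Nat.one_le_two_pow
  unfold hitBound
  rw [← hP]
  calc (4 * n * (n + 1) ^ n + 1) ^ P * n + 1 ≤ 2 ^ ((n * n + n + 3) * P) * 2 ^ n + 1 := by gcongr
    _ = 2 ^ ((n * n + n + 3) * P + n) + 1 := by rw [← pow_add]
    _ ≤ 2 ^ ((n * n + n + 3) * P + n) + 2 ^ ((n * n + n + 3) * P + n) := by omega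
    _ = 2 ^ ((n * n + n + 3) * P + n + 1) := by ring

/-- The exponent is polynomial in `n`:
`2n + n((n²+n+3)P + n + 1) + 2 ≤ 9377 (n+4)^(5b+24)`. [folklore] -/
theorem exponent_le_pow (n b : ℕ) :
    2 * n + n * ((n * n + n + 3) * (9376 * (n + 4) ^ (5 * b + 21)) + n + 1) + 2 ≤
      9377 * (n + 4) ^ (5 * b + 24) := by
  set m := n + 4 with hm
  have hnm : n ≤ m := by omega
  have hq : n * n + n + 3 ≤ m * m := by rw [hm]; ring_nf; omega
  have hm1 : 1 ≤ m := by omega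
  have hrest : n * n + 3 * n + 2 ≤ m ^ (5 * b + 24) := by
    calc n * n + 3 * n + 2 ≤ m * m := by rw [hm]; ring_nf; omega
      _ = m ^ 2 := (pow_two m).symm
      _ ≤ m ^ (5 * b + 24) := Nat.pow_le_pow_right hm1 (by omega)
  have hmain : n * ((n * n + n + 3) * (9376 * m ^ (5 * b + 21))) ≤ 9376 * m ^ (5 * b + 24) := by
    calc n * ((n * n + n + 3) * (9376 * m ^ (5 * b + 21)))
        ≤ m * ((m * m) * (9376 * m ^ (5 * b + 21))) := by gcongr
      _ = 9376 * m ^ (5 * b + 24) := by ring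
  calc 2 * n + n * ((n * n + n + 3) * (9376 * m ^ (5 * b + 21)) + n + 1) + 2
      = n * ((n * n + n + 3) * (9376 * m ^ (5 * b + 21))) + (n * n + 3 * n + 2) := by ring
    _ ≤ 9376 * m ^ (5 * b + 24) + m ^ (5 * b + 24) := Nat.add_le_add hmain hrest
    _ = 9377 * m ^ (5 * b + 24) := by ring

/-- **Threshold.** For `n ≥ n₀(b)`: `n ≥ 6` and `2n + n((n²+n+3)P + n + 1) + 2 ≤ 2^n`. [folklore] -/
theorem threshold (b : ℕ) : ∃ n₀ : ℕ, ∀ n : ℕ, n₀ ≤ n → 6 ≤ n ∧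
    2 * n + n * ((n * n + n + 3) * (9376 * (n + 4) ^ (5 * b + 21)) + n + 1) + 2 ≤ 2 ^ n := by
  obtain ⟨m₀, hm₀⟩ := LowDegreeEquations.eventually_mul_pow_le_two_pow (16 * 9377) (5 * b + 24)
  refine ⟨max m₀ 6, fun n hn => ⟨le_of_max_le_right hn, ?_⟩⟩
  have h1 := hm₀ (n + 4) (by omega)
  have h2 := exponent_le_pow n b
  rw [show (2 : ℕ) ^ (n + 4) = 2 ^ n * 16 by rw [pow_add]; norm_num] at h1
  have h3 : 16 * (9377 * (n + 4) ^ (5 * b + 24)) ≤ 16 * 2 ^ n := by linarith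
  have h4 : 9377 * (n + 4) ^ (5 * b + 24) ≤ 2 ^ n := Nat.le_of_mul_le_mul_left h3 (by norm_num)
  omega

/-- **The pigeonhole inequality** `N · B^n + 1 < 2^N` for `n ≥ n₀(b)`, `B = hitBound n b`,
`N = #degLEMonomials n`. [folklore] -/
theorem card_mul_hitBound_pow_lt {n b : ℕ}
    (hT : 2 * n + n * ((n * n + n + 3) * (9376 * (n + 4) ^ (5 * b + 21)) + n + 1) + 2 ≤ 2 ^ n) :
    Fintype.card (degLEMonomials n) * hitBound n b ^ n + 1 <
      2 ^ Fintype.card (degLEMonomials n) := by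
  set N := Fintype.card (degLEMonomials n) with hN
  set β := (n * n + n + 3) * (9376 * (n + 4) ^ (5 * b + 21)) + n + 1 with hβ
  have hNle : N ≤ 2 ^ (2 * n) :=
    (fintypeCard_degLEMonomials n).le.trans (Nat.choose_le_two_pow _ _)
  have hNge : 2 ^ n ≤ N := two_pow_le_card_degLEMonomials n
  have hB : hitBound n b ^ n ≤ 2 ^ (n * β) := by
    calc hitBound n b ^ n ≤ (2 ^ β) ^ n := Nat.pow_le_pow_left (hitBound_le_two_pow n b) n
      _ = 2 ^ (n * β) := by rw [← pow_mul, mul_comm]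
  have h1 : N * hitBound n b ^ n + 1 ≤ 2 ^ (2 * n + n * β + 1) := by
    have h0 : 1 ≤ 2 ^ (2 * n + n * β) := Nat.one_le_two_pow
    calc N * hitBound n b ^ n + 1 ≤ 2 ^ (2 * n) * 2 ^ (n * β) + 1 := by gcongr
      _ = 2 ^ (2 * n + n * β) + 1 := by rw [← pow_add]
      _ ≤ 2 ^ (2 * n + n * β) + 2 ^ (2 * n + n * β) := by omega
      _ = 2 ^ (2 * n + n * β + 1) := by ring
  have h2 : 2 * n + n * β + 1 < N := by
    have : 2 * n + n * β + 2 ≤ 2 ^ n := by rw [hβ]; exact hT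
    omega
  exact lt_of_le_of_lt h1 (Nat.pow_lt_pow_right (by norm_num) h2)

/-! ### The main theorem -/

/-- **CKRST 2020, Thm. 1.1, in the tree frame, one size exponent at a time (level `a = 5`).** For
every `b` and all large `n` there is a distinguisher `D` of size and degree `≤ N^5` vanishing at the
coefficient vector of every `f ∈ SmallCircuits ℂ n b` with coefficients in `{0, 1, -1}`, and nonzero
at some polynomial `h` of degree `≤ n` with coefficients in `{0, 1, -1}`.
[cite: ChatterjeeKumarRamyaSaptharishiTengse2020, Thm. 1.1] -/
theorem signSlice_naturalProofRel_at (b : ℕ) : ∃ n₀ : ℕ, ∀ n : ℕ, n₀ ≤ n →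
    ∃ D : MvPolynomial (degLEMonomials n) ℂ,
      IsNaturalProofRel (degLEMonomials n) (signCoeffSlice ℂ n) (SmallCircuits ℂ n b)
        (Distinguishers ℂ n 5) D ∧
      ∃ h ∈ signCoeffSlice ℂ n, h.totalDegree ≤ n ∧
        eval (coeffVector (degLEMonomials n) h) D ≠ 0 := by
  classical
  obtain ⟨n₀, hn₀⟩ := threshold b
  refine ⟨n₀, fun n hn => ?_⟩
  obtain ⟨hn6, hT⟩ := hn₀ n hn
  have hn1 : 1 ≤ n := by omega
  set N := Fintype.card (degLEMonomials n) with hN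
  -- the hitting point, the witness, the equation
  obtain ⟨a, ha, hhit⟩ := exists_hitting_point b hn1
  set B := hitBound n b with hB
  have hB1 : 1 ≤ B := one_le_hitBound n b
  have hkey := card_mul_hitBound_pow_lt (b := b) hT
  rw [← hN, ← hB] at hkey
  obtain ⟨e, he0, he, hea⟩ := exists_witness a hB1 (fun i => (ha i).2) hkey
  set K := 2 * N with hK
  set R := N * K with hR
  let D := equation n a K R
  -- `D` is a level-5 distinguisher
  have hNc : N ≤ (2 * n).choose n := (fintypeCard_degLEMonomials n).le
  have hNc64 : 64 ≤ (2 * n).choose n := by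
    have h := LowDegreeEquations.two_pow_le_choose (show 4 ≤ n by omega)
    exact le_trans (by
      calc (64 : ℕ) = 2 ^ 6 := by norm_num
        _ ≤ 2 ^ n := Nat.pow_le_pow_right (by norm_num) hn6) h
  have hN1 : 1 ≤ N := le_trans Nat.one_le_two_pow (two_pow_le_card_degLEMonomials n)
  have hDmem : D ∈ Distinguishers ℂ n 5 := by
    set Nc := (2 * n).choose n with hNcdef
    have hdeg := totalDegree_equation_le n a K R
    have hcx := complexity_equation_le n a K R
    rw [← hN] at hdeg hcx
    have hpow : N ^ 4 ≤ Nc ^ 4 := Nat.pow_le_pow_left hNc 4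
    have h5 : Nc ^ 5 = Nc ^ 4 * Nc := pow_succ Nc 4
    have p3 : N ^ 3 ≤ N ^ 4 := Nat.pow_le_pow_right hN1 (by norm_num)
    have p2 : N ^ 2 ≤ N ^ 4 := Nat.pow_le_pow_right hN1 (by norm_num)
    have p1 : N ≤ N ^ 4 := by
      calc N = N ^ 1 := (pow_one N).symm
        _ ≤ N ^ 4 := Nat.pow_le_pow_right hN1 (by norm_num)
    have p0 : 1 ≤ N ^ 4 := Nat.one_le_pow _ _ hN1
    refine ⟨hcx.trans ?_, hdeg.trans ?_⟩
    · rw [hR, hK]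
      have expand : 4 * N + 3 + 2 * N * ((2 * (N * (2 * N)) + 1) * (2 * N + 2) + 1) =
          16 * N ^ 4 + 16 * N ^ 3 + 4 * N ^ 2 + 10 * N + 3 := by ring
      calc 4 * N + 3 + 2 * N * ((2 * (N * (2 * N)) + 1) * (2 * N + 2) + 1)
          ≤ 49 * N ^ 4 := by rw [expand]; linarith
        _ ≤ 49 * Nc ^ 4 := Nat.mul_le_mul_left _ hpow
        _ ≤ Nc ^ 4 * Nc := by rw [mul_comm]; exact Nat.mul_le_mul_left _ (by omega)
        _ = Nc ^ 5 := h5.symm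
    · rw [hR, hK]
      have expand : 2 * N + 2 * N * (2 * (N * (2 * N)) + 1) = 8 * N ^ 3 + 4 * N := by ring
      calc 2 * N + 2 * N * (2 * (N * (2 * N)) + 1)
          ≤ 12 * N ^ 4 := by rw [expand]; linarith
        _ ≤ 12 * Nc ^ 4 := Nat.mul_le_mul_left _ hpow
        _ ≤ Nc ^ 4 * Nc := by rw [mul_comm]; exact Nat.mul_le_mul_left _ (by omega)
        _ = Nc ^ 5 := h5.symm
  have hRle : N * K ≤ R := le_rfl
  -- the witness
  let h := ofIntVec e
  have hh_mem : h ∈ signCoeffSlice ℂ n := ofIntVec_mem_signCoeffSlice he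
  have hh_ne : eval (coeffVector (degLEMonomials n) h) D ≠ 0 := by
    rw [show coeffVector (degLEMonomials n) h = fun m => ((e m : ℤ) : ℂ) from coeffVector_ofIntVec e]
    refine eval_equation_intCast_ne_zero a hRle he he0 fun r _ _ => ?_
    rw [hea]; exact dvd_zero _
  refine ⟨D, ⟨hDmem, ⟨h, hh_mem, hh_ne⟩, fun f hf hfs => ?_⟩, h, hh_mem, totalDegree_ofIntVec_le e,
    hh_ne⟩
  -- vanishing on the simple members of the slice
  rw [coeffVector_eq_cast_sgnVec hfs]
  by_cases hf0 : f = 0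
  · have : sgnVec f = 0 := by
      funext m; simp [sgnVec, hf0]
    rw [this]
    exact eval_equation_zero a K R
  · have hx : intEval a (sgnVec f) ≠ 0 := by
      intro h0
      apply hhit f hf hfs hf0
      rw [eval_natCast_eq_intEval hfs hf.1, h0, Int.cast_zero]
    have hxlt : (intEval a (sgnVec f)).natAbs < 2 ^ N := by
      refine lt_of_le_of_lt (natAbs_intEval_le hB1 (fun i => (ha i).2) (natAbs_sgnVec_le f)) ?_
      rw [← hN]; omega
    obtain ⟨r, hr2, hrK, hnd⟩ := CRT.exists_not_dvd_int hx hxlt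
    exact eval_equation_intCast_eq_zero_of_not_dvd a hRle (natAbs_sgnVec_le f) hr2
      (by rw [hK]; exact hrK) hnd

/-- **CKRST 2020, Thm. 1.1, tree frame, uniform level.** ONE distinguisher level `a` (namely `5`)
works for every size exponent `b`: natural proofs relative to the sign slice exist against
`SmallCircuits ℂ n b` for all large `n`. [cite: ChatterjeeKumarRamyaSaptharishiTengse2020, Thm. 1.1] -/
theorem signSlice_naturalProofRel : ∃ a : ℕ, ∀ b : ℕ, ∃ n₀ : ℕ, ∀ n : ℕ, n₀ ≤ n →
    ∃ D : MvPolynomial (degLEMonomials n) ℂ,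
      IsNaturalProofRel (degLEMonomials n) (signCoeffSlice ℂ n) (SmallCircuits ℂ n b)
        (Distinguishers ℂ n a) D ∧
      ∃ h ∈ signCoeffSlice ℂ n, h.totalDegree ≤ n ∧
        eval (coeffVector (degLEMonomials n) h) D ≠ 0 :=
  ⟨5, signSlice_naturalProofRel_at⟩

/-- **CKRST 2020, Thm. 1.1, tree frame, as filed by the cell val-lit (GAP row N3, `∀ b, ∃ a n₀, …`).**
[cite: ChatterjeeKumarRamyaSaptharishiTengse2020, Thm. 1.1] -/
theorem signSlice_naturalProofRel' : ∀ b : ℕ, ∃ a n₀ : ℕ, ∀ n : ℕ, n₀ ≤ n →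
    ∃ D : MvPolynomial (degLEMonomials n) ℂ,
      IsNaturalProofRel (degLEMonomials n) (signCoeffSlice ℂ n) (SmallCircuits ℂ n b)
        (Distinguishers ℂ n a) D ∧
      ∃ h ∈ signCoeffSlice ℂ n, h.totalDegree ≤ n ∧
        eval (coeffVector (degLEMonomials n) h) D ≠ 0 :=
  fun b => ⟨5, signSlice_naturalProofRel_at b⟩

/-- **The sign-slice relative hypothesis is false over `ℂ`** (the `P = signCoeffSlice` case of the
tree's narrowed barrier `AlgebraicNaturalProofsNarrow`, recorded there as refuted in print):
`SmallCircuits ℂ n b ∩ {0,1,-1}`-coefficients is NOT a relative succinct hitting set for level-`5`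
distinguishers, whatever `b`. [cite: ChatterjeeKumarRamyaSaptharishiTengse2020, Thm. 1.1 and §1.4] -/
theorem not_succinctHittingSetsForVPRel_signCoeffSlice :
    ¬ SuccinctHittingSetsForVPRel ℂ (signCoeffSlice ℂ) := by
  intro hyp
  obtain ⟨b, n₀, hb⟩ := hyp 5
  obtain ⟨n₁, hn₁⟩ := signSlice_naturalProofRel_at b
  obtain ⟨D, hD, -⟩ := hn₁ (max n₀ n₁) (le_max_right _ _)
  exact (exists_isNaturalProofRel_iff _ _ _ _).mp ⟨D, hD⟩ (hb _ (le_max_left _ _))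

end SignSlice

end Summit.ValiantsHypothesis.ValiantsHypothesis.Theorems.BarrierLever.NaturalProofsSeparateVNP
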